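import Literature.MathematicalPhysics.QuantumLattice.SectorPartitionFloor
import Literature.MathematicalPhysics.QuantumLattice.SectorGroundProjContinuity

/-!
# `KkBandLift` (crux stmt-HubbardSuperconductivity-10402, route `KkFloor`) — negative side, N3:
# Gibbs shell selection (a low-energy sector state with small `A`-expectation, by Markov twice)

Refuter file (B2b-4, HONEST FRAMING: the value here is a THEOREM — a kernel-checked ingredient of
`¬ KkBandLift` — not summit progress).

`gibbsShellSelection` is the proposition `GibbsShellSelection` of the strategist's negation
skeleton `Cruxes/KkBandLift/StrategistNegation.lean` (N3), proved, with the local abbreviation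
`sectorGibbsAvg H K β A = tr (P_K e^{-βH} A) / tr (P_K e^{-βH})` written out: for Hermitian `H`,
an `H`-invariant `K ≠ ⊥`, `A` with nonnegative form and `β > 0`, some unit `φ ∈ K` has
`Re⟨φ,Hφ⟩ ≤ minEnergyOn H K + 2 log(2·card n)/β` and `Re⟨φ,Aφ⟩ ≤ 2 |⟨A⟩_{β,K}|`.

Proof (folklore): in the eigenbasis `uⱼ` of `H` put `wⱼ = P_K uⱼ ∈ K` (again `λⱼ`-eigenvectors,
`[P_K, H] = 0`), `mⱼ = ‖wⱼ‖²`, `aⱼ = Re⟨wⱼ, A wⱼ⟩ ≥ 0`, `qⱼ = e^{-βλⱼ} mⱼ`; then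
`Z = tr (P_K e^{-βH}) = Σ qⱼ ≥ e^{-βe₀}` (`SectorPartitionFloor`), `tr (P_K e^{-βH} A) = Σ e^{-βλⱼ} aⱼ`,
`Σ mⱼ = dim K ≤ card n`; the levels above `e₀ + 2 log(2 card n)/β` carry `Σ qⱼ ≤ Z/4`
(first Markov), so on the remaining levels `Σ e^{-βλⱼ} aⱼ ≤ |tr (P_K e^{-βH} A)| = M Z ≤ (4/3) M Σ qⱼ`
and some level has `aⱼ ≤ (4/3) M mⱼ`, `mⱼ > 0` (second Markov); `φ = wⱼ/‖wⱼ‖`.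

Sources: H. Tasaki, *Physics and Mathematics of Quantum Many-Body Systems* (2020), App. A.2–A.4;
O. Bratteli, D. W. Robinson, *Operator Algebras and Quantum Statistical Mechanics II*, §5.3.1.
Folklore; no definition is introduced.
-/

set_option linter.dupNamespace false

noncomputable section

namespace Summit.HubbardSuperconductivity.HubbardSuperconductivity.Theorems.KkBandLift.Negative

open Matrix Complex
open scoped ComplexOrder Matrix.Norms.L2Operator MatrixOrder InnerProductSpace
open Literature.MathematicalPhysics.QuantumLattice
open Literature.MathematicalPhysics.QuantumLattice.EigenvalueContinuation
  (im_star_dotProduct_self re_star_dotProduct_self_nonneg star_real_smul_dotProduct_real_smul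
    exists_normalize)

/-- `tr (M diag(d) Mᴴ B) = Σᵢ dᵢ ⟨mᵢ, B mᵢ⟩`, `mᵢ` the columns of `M`. [folklore] -/
theorem trace_mul_diagonal_mul_conjTranspose_mul {n : Type*} [Fintype n] [DecidableEq n]
    (M B : Matrix n n ℂ) (d : n → ℂ) :
    (M * diagonal d * Mᴴ * B).trace =
      ∑ i, d i * (star (fun k => M k i) ⬝ᵥ B *ᵥ fun k => M k i) := by
  have h : M * diagonal d * Mᴴ * B = M * (diagonal d * (Mᴴ * B)) := by
    simp only [Matrix.mul_assoc]
  rw [h, trace_mul_comm, Matrix.mul_assoc, trace]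
  refine Finset.sum_congr rfl fun i _ => ?_
  rw [diag_apply, diagonal_mul]
  congr 1
  simp only [mul_apply, conjTranspose_apply, dotProduct, mulVec, Pi.star_apply, Finset.mul_sum,
    Finset.sum_mul]
  rw [Finset.sum_comm]
  refine Finset.sum_congr rfl fun l _ => Finset.sum_congr rfl fun k _ => ?_
  ring

/-- **N3 `GibbsShellSelection`** of `Cruxes/KkBandLift/StrategistNegation.lean`, with
`sectorGibbsAvg` unfolded. For Hermitian `H`, an `H`-invariant `K ≠ ⊥`, `A` with nonnegative form
and `β > 0`: some unit `φ ∈ K` has energy `≤ minEnergyOn H K + 2 log(2·card n)/β` and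
`Re⟨φ,Aφ⟩ ≤ 2 |tr (P_K e^{-βH} A) / tr (P_K e^{-βH})|`. Tasaki (2020) App. A. [folklore] -/
theorem gibbsShellSelection :
    ∀ (n : Type) [Fintype n] [DecidableEq n] (H A : Matrix n n ℂ) (K : Submodule ℂ (n → ℂ))
      (β : ℝ), H.IsHermitian → (∀ v ∈ K, H *ᵥ v ∈ K) →
      (∀ v : n → ℂ, 0 ≤ (star v ⬝ᵥ A *ᵥ v).re) → K ≠ ⊥ → 0 < β →
      ∃ φ ∈ K, star φ ⬝ᵥ φ = 1 ∧
        (star φ ⬝ᵥ H *ᵥ φ).re ≤ H.minEnergyOn K + 2 * Real.log (2 * Fintype.card n) / β ∧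
        (star φ ⬝ᵥ A *ᵥ φ).re ≤
          2 * ‖(projMatrix (K.map ((WithLp.linearEquiv 2 ℂ (n → ℂ)).symm :
                (n → ℂ) →ₗ[ℂ] EuclideanSpace ℂ n)) * gibbsWeight β H * A).trace /
              (projMatrix (K.map ((WithLp.linearEquiv 2 ℂ (n → ℂ)).symm :
                (n → ℂ) →ₗ[ℂ] EuclideanSpace ℂ n)) * gibbsWeight β H).trace‖ := by
  intro n _ _ H A K β hH hinv hA hK hβ
  classical
  -- the Gibbs weight in the eigenbasis (as in `SectorPartitionFloor`)
  have hgW : gibbsWeight β H = (hH.eigenvectorUnitary : Matrix n n ℂ) *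
      diagonal (fun i => (Real.exp (-(β * hH.eigenvalues i)) : ℂ)) *
        star (hH.eigenvectorUnitary : Matrix n n ℂ) := by
    have hsmul : (-(β : ℂ) • H : Matrix n n ℂ) = (-β : ℝ) • H := by
      ext i j
      simp [Matrix.smul_apply, Complex.real_smul]
    have h1 : gibbsWeight β H = cfc (fun x : ℝ => Real.exp ((-β) • x)) H := by
      rw [gibbsWeight, hsmul, cfc_comp_smul (-β) Real.exp H, CFC.real_exp_eq_normedSpace_exp]
    rw [h1, hH.cfc_eq, IsHermitian.cfc, Unitary.conjStarAlgAut_apply]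
    simp only [smul_eq_mul, neg_mul]
    rfl
  set P := projMatrix (K.map ((WithLp.linearEquiv 2 ℂ (n → ℂ)).symm :
    (n → ℂ) →ₗ[ℂ] EuclideanSpace ℂ n)) with hP
  set e₀ : ℝ := H.minEnergyOn K with he₀
  set N : ℕ := Fintype.card n with hN
  set T : ℝ := 2 * Real.log (2 * (N : ℝ)) / β with hT
  set U : Matrix n n ℂ := (hH.eigenvectorUnitary : Matrix n n ℂ) with hU
  have hPherm : P.IsHermitian := projMatrix_isHermitian _
  have hPP : P * P = P := projMatrix_mul_self _
  have hPH : P * H = H * P := projMatrix_map_commute_of_invariant hH K hinv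
  have hUU : U * star U = 1 := Unitary.mul_star_self_of_mem hH.eigenvectorUnitary.prop
  -- `n` is nonempty (`K ≠ ⊥`), so `N ≥ 1`
  obtain ⟨v0, -, hv0⟩ := Submodule.exists_mem_ne_zero_of_ne_bot hK
  haveI : Nonempty n := by
    by_contra hne
    exact hv0 (funext fun i => absurd ⟨i⟩ hne)
  have hN1 : (1 : ℝ) ≤ N := by exact_mod_cast (Fintype.card_pos : 0 < N)
  have hNpos : (0 : ℝ) < N := by linarith
  -- the projected eigenvectors `wⱼ = P uⱼ ∈ K`
  have hcol : ∀ j, H *ᵥ (fun i => U i j) = ((hH.eigenvalues j : ℝ) : ℂ) • (fun i => U i j) := by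
    intro j
    have h : (fun i => U i j) = ⇑(hH.eigenvectorBasis j) :=
      funext fun i => IsHermitian.eigenvectorUnitary_apply hH i j
    rw [h, hH.mulVec_eigenvectorBasis j, RCLike.real_smul_eq_coe_smul (K := ℂ)]
    rfl
  have hw_eq : ∀ j, (fun k => (P * U) k j) = P *ᵥ fun k => U k j := by
    intro j
    funext k
    simp only [mul_apply, mulVec, dotProduct]
  have hwK : ∀ j, (fun k => (P * U) k j) ∈ K := fun j => by
    rw [hw_eq]
    exact projMatrix_map_mulVec_mem K _
  have hHw : ∀ j, H *ᵥ (fun k => (P * U) k j) =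
      ((hH.eigenvalues j : ℝ) : ℂ) • (fun k => (P * U) k j) := by
    intro j
    rw [hw_eq, mulVec_mulVec, ← hPH, ← mulVec_mulVec, hcol, mulVec_smul]
  -- weights
  set lam : n → ℝ := hH.eigenvalues with hlam
  set m : n → ℝ := fun j => (star (fun k => (P * U) k j) ⬝ᵥ fun k => (P * U) k j).re with hm
  set a : n → ℝ := fun j => (star (fun k => (P * U) k j) ⬝ᵥ A *ᵥ fun k => (P * U) k j).re
    with ha_def
  set q : n → ℝ := fun j => Real.exp (-(β * lam j)) * m j with hq
  have hm0 : ∀ j, 0 ≤ m j := fun j => re_star_dotProduct_self_nonneg _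
  have ha0 : ∀ j, 0 ≤ a j := fun j => hA _
  have hmC : ∀ j, (star (fun k => (P * U) k j) ⬝ᵥ fun k => (P * U) k j) = ((m j : ℝ) : ℂ) := by
    intro j
    refine Complex.ext ?_ ?_
    · rw [Complex.ofReal_re, hm]
    · rw [Complex.ofReal_im, im_star_dotProduct_self]
  -- the Gibbs weight compressed by `P` on both sides
  have hcomm : P * gibbsWeight β H = gibbsWeight β H * P := by
    have hc : Commute P H := hPH
    have : Commute P (gibbsWeight β H) := by
      unfold gibbsWeight
      exact (hc.smul_right _).exp_right
    exact this.eq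
  have hPgW : P * gibbsWeight β H =
      P * U * diagonal (fun i => (Real.exp (-(β * lam i)) : ℂ)) * (P * U)ᴴ := by
    have h1 : P * gibbsWeight β H = P * (gibbsWeight β H * P) := by
      rw [← hcomm, ← Matrix.mul_assoc, hPP]
    rw [h1, hgW, conjTranspose_mul, hPherm.eq, ← star_eq_conjTranspose]
    simp only [Matrix.mul_assoc]
  -- `Z = tr (P e^{-βH}) = Σ qⱼ` (real, positive, `≥ e^{-βe₀}`)
  set Z : ℝ := ∑ j, q j with hZdef
  have hZc : (P * gibbsWeight β H).trace = ((Z : ℝ) : ℂ) := by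
    rw [← Matrix.mul_one (P * gibbsWeight β H), hPgW, trace_mul_diagonal_mul_conjTranspose_mul,
      hZdef]
    push_cast
    refine Finset.sum_congr rfl fun j _ => ?_
    rw [one_mulVec, hmC j, hq]
    push_cast
    rfl
  have hE₀ := inf_eigenspace_minEnergyOn_ne_bot hH K hinv hK
  have hZpos : 0 < Z := by
    have h := re_trace_proj_gibbsWeight_pos hH K hinv hE₀ β
    rwa [← hP, hZc, Complex.ofReal_re] at h
  have hZge : Real.exp (-(β * e₀)) ≤ Z := by
    have h := exp_neg_mul_minEnergyOn_le_re_trace_proj_gibbsWeight hH K hinv hE₀ β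
    rwa [← hP, ← he₀, hZc, Complex.ofReal_re] at h
  -- `tr (P e^{-βH} A) = Σ e^{-βλⱼ} aⱼ`
  have hTA_re : ((P * gibbsWeight β H * A).trace).re = ∑ j, Real.exp (-(β * lam j)) * a j := by
    rw [hPgW, trace_mul_diagonal_mul_conjTranspose_mul, Complex.re_sum]
    refine Finset.sum_congr rfl fun j _ => ?_
    rw [Complex.re_ofReal_mul]
  -- `Σ mⱼ = dim K ≤ card n`
  have hsum_m : ∑ j, m j ≤ N := by
    have h1 : P * U * diagonal (fun _ => (1 : ℂ)) * (P * U)ᴴ * 1 = P := by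
      rw [diagonal_one, Matrix.mul_one, Matrix.mul_one, conjTranspose_mul, hPherm.eq,
        ← star_eq_conjTranspose, Matrix.mul_assoc, ← Matrix.mul_assoc U, hUU, Matrix.one_mul, hPP]
    have h2 : (P.trace).re = ∑ j, m j := by
      rw [← h1, trace_mul_diagonal_mul_conjTranspose_mul, Complex.re_sum]
      refine Finset.sum_congr rfl fun j _ => ?_
      rw [one_mul, one_mulVec]
    rw [← h2, hP, trace_projMatrix_map_eq_finrank, Complex.natCast_re]
    have h3 : Module.finrank ℂ K ≤ N := by
      rw [hN, ← Module.finrank_fintype_fun_eq_card ℂ]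
      exact Submodule.finrank_le K
    exact_mod_cast h3
  -- first Markov: the levels above `e₀ + T` carry Gibbs weight `≤ Z/4`
  have hexpT : Real.exp (-(β * T)) = 1 / (4 * (N : ℝ) ^ 2) := by
    have hβT : β * T = Real.log ((2 * (N : ℝ)) ^ 2) := by
      rw [hT, Real.log_pow]
      field_simp
      ring
    rw [hβT, Real.exp_neg, Real.exp_log (by positivity)]
    ring
  have hhigh : ∑ j ∈ Finset.univ.filter (fun j => ¬ lam j ≤ e₀ + T), q j ≤ Z / 4 := by
    calc ∑ j ∈ Finset.univ.filter (fun j => ¬ lam j ≤ e₀ + T), q j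
        ≤ ∑ j ∈ Finset.univ.filter (fun j => ¬ lam j ≤ e₀ + T),
            Real.exp (-(β * (e₀ + T))) * m j := by
          refine Finset.sum_le_sum fun j hj => ?_
          rw [Finset.mem_filter] at hj
          refine mul_le_mul_of_nonneg_right (Real.exp_le_exp.2 ?_) (hm0 j)
          have := mul_le_mul_of_nonneg_left (le_of_lt (not_le.1 hj.2)) hβ.le
          linarith
      _ = Real.exp (-(β * (e₀ + T))) * ∑ j ∈ Finset.univ.filter (fun j => ¬ lam j ≤ e₀ + T), m j := by
          rw [Finset.mul_sum]
      _ ≤ Real.exp (-(β * (e₀ + T))) * N := by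
          refine mul_le_mul_of_nonneg_left ?_ (Real.exp_pos _).le
          exact (Finset.sum_le_univ_sum_of_nonneg hm0).trans hsum_m
      _ = Real.exp (-(β * e₀)) / 4 * (1 / N) := by
          rw [mul_add, neg_add, Real.exp_add, hexpT]
          field_simp
      _ ≤ Real.exp (-(β * e₀)) / 4 * 1 := by
          refine mul_le_mul_of_nonneg_left ?_ (by positivity)
          rw [div_le_one hNpos]
          exact hN1
      _ ≤ Z / 4 := by linarith
  have hlo : 3 * Z / 4 ≤ ∑ j ∈ Finset.univ.filter (fun j => lam j ≤ e₀ + T), q j := by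
    have hsplit := Finset.sum_filter_add_sum_filter_not Finset.univ (fun j => lam j ≤ e₀ + T) q
    rw [← hZdef] at hsplit
    linarith
  -- the selection set: low levels actually present in the sector
  set s : Finset n := Finset.univ.filter (fun j => lam j ≤ e₀ + T ∧ 0 < m j) with hs
  have hs_sum : ∑ j ∈ Finset.univ.filter (fun j => lam j ≤ e₀ + T), q j = ∑ j ∈ s, q j := by
    rw [hs, Finset.sum_filter, Finset.sum_filter]
    refine Finset.sum_congr rfl fun j _ => ?_
    by_cases h1 : lam j ≤ e₀ + T
    · by_cases h2 : 0 < m j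
      · rw [if_pos h1, if_pos ⟨h1, h2⟩]
      · have hmj : m j = 0 := le_antisymm (not_lt.1 h2) (hm0 j)
        rw [if_pos h1, if_neg (fun h => h2 h.2), hq]
        simp only [hmj, mul_zero]
    · rw [if_neg h1, if_neg (fun h => h1 h.1)]
  have hs_ne : s.Nonempty := by
    by_contra h
    rw [Finset.not_nonempty_iff_eq_empty] at h
    have h0 : ∑ j ∈ s, q j = 0 := by rw [h, Finset.sum_empty]
    linarith
  -- second Markov on `s`
  set Zc := (P * gibbsWeight β H).trace with hZc_def
  set TA := (P * gibbsWeight β H * A).trace with hTA_def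
  set M : ℝ := ‖TA / Zc‖ with hM
  have hM0 : 0 ≤ M := norm_nonneg _
  have hZc_norm : ‖Zc‖ = Z := by
    rw [hZc, Complex.norm_real, Real.norm_eq_abs, abs_of_pos hZpos]
  have hTA_norm : ‖TA‖ = M * Z := by
    rw [hM, norm_div, hZc_norm, div_mul_cancel₀ _ hZpos.ne']
  have hre_le : ∑ j, Real.exp (-(β * lam j)) * a j ≤ M * Z := by
    rw [← hTA_re, ← hTA_norm]
    exact Complex.re_le_norm _
  have hmain : ∑ j ∈ s, Real.exp (-(β * lam j)) * a j ≤ ∑ j ∈ s, 4 / 3 * M * q j := by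
    calc ∑ j ∈ s, Real.exp (-(β * lam j)) * a j ≤ ∑ j, Real.exp (-(β * lam j)) * a j :=
          Finset.sum_le_univ_sum_of_nonneg fun j => mul_nonneg (Real.exp_pos _).le (ha0 j)
      _ ≤ M * Z := hre_le
      _ ≤ M * (4 / 3 * ∑ j ∈ s, q j) := by
          refine mul_le_mul_of_nonneg_left ?_ hM0
          linarith
      _ = ∑ j ∈ s, 4 / 3 * M * q j := by
          rw [← Finset.mul_sum]
          ring
  obtain ⟨j, hjs, hj⟩ := Finset.exists_le_of_sum_le hs_ne hmain
  have hjs' : lam j ≤ e₀ + T ∧ 0 < m j := by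
    rw [hs, Finset.mem_filter] at hjs
    exact hjs.2
  obtain ⟨hjlo, hjm⟩ := hjs'
  have haj : a j ≤ 4 / 3 * M * m j := by
    have hexp : 0 < Real.exp (-(β * lam j)) := Real.exp_pos _
    have h' : Real.exp (-(β * lam j)) * a j ≤ Real.exp (-(β * lam j)) * (4 / 3 * M * m j) := by
      calc Real.exp (-(β * lam j)) * a j ≤ 4 / 3 * M * q j := hj
        _ = Real.exp (-(β * lam j)) * (4 / 3 * M * m j) := by rw [hq]; ring
    exact le_of_mul_le_mul_left h' hexp
  -- normalise `wⱼ`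
  have hwne : (fun k => (P * U) k j) ≠ 0 := by
    intro h0
    have : m j = 0 := by
      rw [hm]
      simp only [h0, star_zero, zero_dotProduct, Complex.zero_re]
    linarith
  obtain ⟨c, -, hcc, hc1⟩ := exists_normalize hwne
  have hccm : c * c * m j = 1 := hcc
  refine ⟨(c : ℂ) • (fun k => (P * U) k j), K.smul_mem _ (hwK j), hc1, ?_, ?_⟩
  · rw [mulVec_smul, star_real_smul_dotProduct_real_smul, Complex.re_ofReal_mul, hHw j,
      dotProduct_smul, smul_eq_mul, Complex.re_ofReal_mul]
    calc c * c * (lam j * (star (fun k => (P * U) k j) ⬝ᵥ fun k => (P * U) k j).re)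
        = lam j * (c * c * m j) := by rw [hm]; ring
      _ = lam j := by rw [hccm, mul_one]
      _ ≤ e₀ + T := hjlo
  · rw [mulVec_smul, star_real_smul_dotProduct_real_smul, Complex.re_ofReal_mul]
    calc c * c * (star (fun k => (P * U) k j) ⬝ᵥ A *ᵥ fun k => (P * U) k j).re
        = c * c * a j := by rw [ha_def]
      _ ≤ c * c * (4 / 3 * M * m j) := mul_le_mul_of_nonneg_left haj (mul_self_nonneg c)
      _ = 4 / 3 * M * (c * c * m j) := by ring
      _ = 4 / 3 * M := by rw [hccm, mul_one]
      _ ≤ 2 * M := by nlinarith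
      _ = 2 * ‖TA / Zc‖ := by rw [hM]

end Summit.HubbardSuperconductivity.HubbardSuperconductivity.Theorems.KkBandLift.Negative

end
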